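import Summits.BirchSwinnertonDyer.BirchSwinnertonDyer.Theorems.KatoDescentPotSupersingularKatoSelmerPTCokernel
import HarnessLib

/-!
# The SHARP Poitou–Tate cokernel bound for Kato's `S(E[p^∞])`:
# `#Sel_{p^∞}(E/ℚ) · ∏_{ℓ ∈ T∖{p}} #H¹_ur(ℚ_ℓ, E[p^∞]) · #H ≤ #S · [E(ℚ) : p^K E(ℚ)]` for every subgroup `H` of Kummer classes ORTHOGONAL
# to the test tuples — companion (ii) of crux M's level-0 ledger WITH the factor that the non-sharp count (`…KatoSelmerPTCokernel`) drops
# (route `KatoDescentPotSupersingular` / `…Tame…`, crux M = stmt-BirchSwinnertonDyer-19196, U₀-red 19190/19203; route-free helper)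

Seat `bsd-potss-rkm` g24 (prover; cell `bsd-potss`), TARGET R283 / wake W-M6 (`--supports …`; closes nothing).  HONEST FRAMING: BSD is not
proved by any of this; nothing is booked; theorems only (no definition, no named fact).  The Poitou–Tate input is the FINITE-LEVEL
`SelmerComplement` property of a family of local invariant maps, carried as a hypothesis exactly as in the cell's other PT counts.

## Why

In print (Kato, Astérisque 295, p. 244; Greenberg LNM 1716 app. §4 + Cassels) the cokernel of `S(T) → ⊕_{ℓ≠p} H¹_ur(ℚ_ℓ, E[p^∞])` has order
`#E(ℚ)[p^∞] / #H¹_f(ℤ[1/p], T)`; part 44b (`natCard_selmerGroupPInfty_mul_prod_unramified_le`) bounds it by `#G₀ = [E(ℚ) : p^K E(ℚ)]` alone, and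
this one factor is the whole difference between the ledger's count (`2·ord_p #W(ℚ)_tors`, part 54) and Kato's exact member count (`MemberCountInputs`,
the held input of U₀-red).  Part 44b's mechanism: a tuple `g = (g_ℓ)` killed by the functionals `ev(g) : x ↦ Σ_ℓ ⟨g_ℓ, (desc^♭)_* loc_ℓ x⟩_ℓ`
(`x ∈ G₀ = Sel^{(p^K)} ⊓ ker (E[p^K] ↪ E)_*`) lifts to `S` ((★), part 44a), and `[G : ker ev] ≤ #Hom(G₀, ℤ/N) = #G₀`.  If a subgroup `H ≤ G₀` is
known to be killed by EVERY `ev(g)`, the functionals factor through `G₀/H` and `[G : ker ev] ≤ #(G₀/H) = #G₀/#H`.  This file proves the count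
in that form, for an ABSTRACT `H` (hypotheses: `H ≤ G₀`; `⟨g_ℓ, (desc^♭)_* loc_ℓ x⟩_ℓ = 0` for all `ℓ ∈ T∖p`, `g_ℓ ∈ ι_K⁻¹H¹_ur`, `x ∈ H`); the
companion files supply `H = ι′_* red_{p^K}(A_tors)` (`…H1TateTorsionKummer`: it lies in `G₀`, of order `#A_tors`; `…UnramifiedLevelRaise` +
Milne I 2.6: the orthogonality).

## What

* `natCard_selmerGroupPInfty_mul_prod_unramified_mul_le` — part 44b's hypotheses verbatim plus `(H, hHle, hH)`:
  **`#Sel_{p^∞}(E/ℚ) · ∏_{ℓ ∈ T∖{p}} #H¹_ur(ℚ_ℓ, E[p^∞]) · #H ≤ #S · #G₀`**; `…_index`: the same with `#G₀ = [E(ℚ) : p^K E(ℚ)]` (part 41).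

References: K. Kato, Astérisque 295 (2004), §14.8 (p. 238), proof of Prop. 14.16 (pp. 244–245) [Kato2004Asterisque]; R. Greenberg, LNM 1716
(1999), appendix to §4 (Cassels' theorem) [GreenbergLNM1716]; J. S. Milne, *ADT* I Thm. 4.10 (b), Cor. 2.3, Lemma 3.3 [MilneADT2006]; B. Howard,
Compos. Math. 140 (2004) Thm. 2.1.11 [Howard2004HeegnerKolyvagin].
-/

-- the summit and its single problem are both named `BirchSwinnertonDyer` (registry layout D-0017)
set_option linter.dupNamespace false
set_option autoImplicit false

noncomputable section

open scoped Classical ContRepresentation NumberField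
open CategoryTheory Function Field NumberField IsDedekindDomain WeierstrassCurve
open Literature.NumberTheory.EllipticCurves Literature.NumberTheory.GaloisRepresentations
  Literature.NumberTheory.GaloisRepresentations.DiscreteGaloisModule Literature.NumberTheory.GaloisCohomology
open Literature.NumberTheory.EllipticCurves.Kato2004
open Summit.BirchSwinnertonDyer.Rank1Residual.X11b.Levels Summit.BirchSwinnertonDyer.Rank1Residual.X11b.LocBridge
  Summit.BirchSwinnertonDyer.Rank1Residual.X11b.LevelKummer
open Summit.BirchSwinnertonDyer.Rank1Residual.GaloisImage
open Summit.BirchSwinnertonDyer.BirchSwinnertonDyer.Theorems.KummerTowerOrthogonal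

universe u

namespace Summit.BirchSwinnertonDyer.BirchSwinnertonDyer.Theorems.KatoFiniteLevelCount

/-! ## §0 Functionals vanishing on a subgroup factor through the quotient -/

section Counting

/-- `[G : ker e] ≤ #(G₀/H₀)` for any `e : G → Hom(G₀, ℤ/N)` all of whose values kill `H₀ ≤ G₀` (`G₀/H₀` finite, killed by `N`): the values
factor through `Hom(G₀/H₀, ℤ/N)`, of order `#(G₀/H₀)` (part 44b `index_ker_le_natCard`). [folklore] -/
theorem index_ker_le_natCard_quotient {G G₀ : Type*} [AddCommGroup G] [AddCommGroup G₀] {N : ℕ} [NeZero N]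
    (H₀ : AddSubgroup G₀) [Finite (G₀ ⧸ H₀)] (hQ : ∀ q : G₀ ⧸ H₀, N • q = 0) (e : G →+ (G₀ →+ ZMod N))
    (he : ∀ g, ∀ x ∈ H₀, e g x = 0) : e.ker.index ≤ Nat.card (G₀ ⧸ H₀) := by
  let eq : G →+ (G₀ ⧸ H₀ →+ ZMod N) :=
    { toFun := fun g => QuotientAddGroup.lift H₀ (e g) fun x hx => he g x hx
      map_zero' := QuotientAddGroup.addMonoidHom_ext _ (by
        rw [QuotientAddGroup.lift_comp_mk', map_zero, AddMonoidHom.zero_comp])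
      map_add' := fun a b => QuotientAddGroup.addMonoidHom_ext _ (by
        rw [QuotientAddGroup.lift_comp_mk', map_add, AddMonoidHom.add_comp, QuotientAddGroup.lift_comp_mk',
          QuotientAddGroup.lift_comp_mk']) }
  have heq : ∀ g, (eq g).comp (QuotientAddGroup.mk' H₀) = e g := fun g =>
    QuotientAddGroup.lift_comp_mk' H₀ (e g) fun x hx => he g x hx
  have hker : eq.ker = e.ker := by
    ext g
    rw [AddMonoidHom.mem_ker, AddMonoidHom.mem_ker]
    constructor
    · intro hg; rw [← heq g, hg, AddMonoidHom.zero_comp]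
    · intro hg
      refine QuotientAddGroup.addMonoidHom_ext _ ?_
      rw [heq g, hg, AddMonoidHom.zero_comp]
  rw [← hker]
  exact index_ker_le_natCard hQ eq

end Counting

/-! ## §1 The sharp count -/

section PT

variable (W : WeierstrassCurve ℚ) [W.IsElliptic] (p s k : ℕ) [Fact p.Prime]
  (T : Finset (HeightOneSpectrum (𝓞 ℚ)))
  (e : geomTorsion W ((p ^ s * p ^ k : ℕ) : ℤ) → geomTorsion W ((p ^ s * p ^ k : ℕ) : ℤ) → AlgebraicClosure ℚ)
  (hμ : ∀ S T, e S T ^ (p ^ s * p ^ k) = 1)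
  (hadd₁ : ∀ S₁ S₂ T, e (S₁ + S₂) T = e S₁ T * e S₂ T)
  (hadd₂ : ∀ S T₁ T₂, e S (T₁ + T₂) = e S T₁ * e S T₂)
  (hgal : ∀ (σ : absoluteGaloisGroup ℚ) (S T : geomTorsion W ((p ^ s * p ^ k : ℕ) : ℤ)), σ • e S T = e (σ • S) (σ • T))
  (inv : LocalInvariants ℚ (p ^ s * p ^ k))
  [Finite (geomTorsion W ((p ^ s * p ^ k : ℕ) : ℤ))] [Finite (geomTorsion W ((p ^ k : ℕ) : ℤ))]

include hμ hadd₁ hadd₂ hgal in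
/-- **THE SHARP POITOU–TATE COKERNEL BOUND: `#Sel_{p^∞}(E/ℚ) · ∏_{ℓ ∈ T∖{p}} #H¹_ur(ℚ_ℓ, E[p^∞]) · #H ≤ #S · #G₀`**,
`G₀ = Sel^{(p^K)}(E/ℚ) ⊓ ker (E[p^K] ↪ E)_*`, for every subgroup `H ≤ G₀` whose classes are ORTHOGONAL at each `ℓ ∈ T∖p` to every
`g_ℓ ∈ ι_K⁻¹ H¹_ur(ℚ_ℓ, E[p^∞])` under `⟨g_ℓ, (desc^♭)_* loc_ℓ ·⟩_ℓ` — part 44b's hypotheses otherwise verbatim (`p` odd; `T ∋ v_p` containing the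
bad places; `p^K` killing every `H¹_ur(ℚ_ℓ, E[p^∞])`, `ℓ ∈ T∖p`; `p^s` killing the `p^s p^K`-torsion of `Ш`; a perfect family `inv` at level `p^s p^K`
with `SelmerComplement`; the relaxed structure `𝓖′`).  Count: the functionals `ev(g)` vanish on `H`, so they factor through `G₀/H`:
`∏ #H¹_ur ≤ #Θ(ker ev) · [G : ker ev] ≤ #im Λ · #Hom(G₀/H, ℤ/p^s p^K) = #im Λ · #G₀/#H` and `#S = #ker Λ · #im Λ`, `#Sel_{p^∞} ≤ #ker Λ`.
[cite: Kato2004Asterisque, §14.8 (p. 238) and proof of Prop. 14.16 (pp. 244–245)] [cite: GreenbergLNM1716, appendix to §4]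
[cite: MilneADT2006, Ch. I, Thm. 4.10 (b) and Lemma 3.3] -/
theorem natCard_selmerGroupPInfty_mul_prod_unramified_mul_le
    (hodd : p ≠ 2) (hk1 : 1 ≤ k)
    (halt : ∀ P, e P P = 1) (hnondeg : ∀ P, (∀ Q, e Q P = 1) → P = 0) (hperf : inv.IsPerfect)
    (hcompl : inv.SelmerComplement)
    (hpT : primePlace p ∈ T) (hT : ∀ v : HeightOneSpectrum (𝓞 ℚ), v ∉ T → W.HasGoodReductionAt v)
    [Finite (W.selmerGroupPInfty p)]
    (𝓤inf : SelmerStructure (primaryGaloisModule W p))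
    (hUp : 𝓤inf (Sum.inr (primePlace p)) = ⊤)
    (hUur : ∀ v : HeightOneSpectrum (𝓞 ℚ), v ≠ primePlace p →
      𝓤inf (Sum.inr v) = unramifiedSubgroup (GaloisRep.toLocal v (primaryGaloisModule W p)) 1)
    (hUinl : ∀ w : InfinitePlace ℚ, 𝓤inf (Sum.inl w) = ⊤)
    (𝓖' : SelmerStructure (W.torsionGaloisModule ((p ^ s * p ^ k : ℕ) : ℤ)))
    (hle : W.kummerSelmerStructure ((p ^ s * p ^ k : ℕ) : ℤ) ≤ 𝓖')
    (h𝓖good : ∀ v : HeightOneSpectrum (𝓞 ℚ), v ∉ T →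
      𝓖' (Sum.inr v) = unramifiedSubgroup (GaloisRep.toLocal v (W.torsionGaloisModule ((p ^ s * p ^ k : ℕ) : ℤ))) 1)
    (h𝓖T : ∀ v ∈ T, v ≠ primePlace p →
      𝓖' (Sum.inr v) = (unramifiedSubgroup (GaloisRep.toLocal v (primaryGaloisModule W p)) 1).comap
        (galoisCohomology.map (((primaryInclusion W p (s + k)).comp
          (W.torsionInclusion (natCast_pow_mul_pow_dvd_natCast_pow_add p s k))).restrictField (v.adicCompletion ℚ)) 1))
    (h𝓖p : 𝓖' (Sum.inr (primePlace p)) = W.kummerSelmerStructure ((p ^ s * p ^ k : ℕ) : ℤ) (Sum.inr (primePlace p)))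
    (hs : ∀ a ∈ W.sha, ((p ^ s * p ^ k : ℕ) : ℤ) • a = 0 → p ^ s • a = 0)
    (hK : ∀ v ∈ T \ {primePlace p},
      ∀ u ∈ unramifiedSubgroup (GaloisRep.toLocal v (primaryGaloisModule W p)) 1, p ^ k • u = 0)
    (H : AddSubgroup (galH1Torsion W ((p ^ k : ℕ) : ℤ)))
    (hHle : H ≤ selmerGroup W ((p ^ k : ℕ) : ℤ) ⊓ (torsionH1ToH1 W ((p ^ k : ℕ) : ℤ)).ker)
    (hH : ∀ ℓ : ↥(T \ {primePlace p}),
      ∀ gℓ ∈ (unramifiedSubgroup (GaloisRep.toLocal ℓ.1 (primaryGaloisModule W p)) 1).comap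
        (galoisCohomology.map ((primaryInclusion W p k).restrictField (ℓ.1.adicCompletion ℚ)) 1),
      ∀ x ∈ H,
        localTatePairingZMod (W.torsionGaloisModule ((p ^ k : ℕ) : ℤ)) (p ^ s * p ^ k) (Sum.inr ℓ.1) (inv (Sum.inr ℓ.1)) gℓ
          (galoisCohomology.map ((DiscreteGaloisModule.pairingDualIntertwining
              (ρ₁ := W.torsionGaloisModule ((p ^ k : ℕ) : ℤ)) (ρ₂ := W.torsionGaloisModule ((p ^ k : ℕ) : ℤ))
              (B := descendHom W (p ^ s) (p ^ k) e hμ hadd₁ hadd₂)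
              (descendHom_smul W (p ^ s) (p ^ k) e hμ hadd₁ hadd₂ hgal)).restrictField (ℓ.1.adicCompletion ℚ)) 1
            (galoisCohomology.localization (W.torsionGaloisModule ((p ^ k : ℕ) : ℤ)) (Sum.inr ℓ.1) 1 x)) = 0) :
    Nat.card (W.selmerGroupPInfty p) *
        (∏ v ∈ T \ {primePlace p}, Nat.card (unramifiedSubgroup (GaloisRep.toLocal v (primaryGaloisModule W p)) 1)) *
        Nat.card H ≤
      Nat.card ↥(𝓤inf.selmerGroup ⊓ selmerLocalKerPrimary W ((primePlace p).adicCompletion ℚ) p) *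
        Nat.card ↥(selmerGroup W ((p ^ k : ℕ) : ℤ) ⊓ (torsionH1ToH1 W ((p ^ k : ℕ) : ℤ)).ker) := by
  classical
  haveI := neZero_pow p s; haveI := neZero_pow p k
  have hp : p.Prime := Fact.out
  haveI : NeZero (p ^ s * p ^ k) := ⟨mul_ne_zero (pow_ne_zero _ hp.ne_zero) (pow_ne_zero _ hp.ne_zero)⟩
  have hι : ∀ ℓ : ↥(T \ {primePlace p}), ℓ.1 ∈ T ∧ ℓ.1 ≠ primePlace p := fun ℓ => by
    have h := Finset.mem_sdiff.1 ℓ.2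
    exact ⟨h.1, fun h' => h.2 (Finset.mem_singleton.2 h')⟩
  have hpℓ : ∀ ℓ : ↥(T \ {primePlace p}), ((p : ℕ) : 𝓞 ℚ) ∉ ℓ.1.asIdeal := fun ℓ =>
    natCast_not_mem_of_ne_primePlace p (hι ℓ).2
  -- Kato's `S` and its finiteness
  set S := 𝓤inf.selmerGroup ⊓ selmerLocalKerPrimary W ((primePlace p).adicCompletion ℚ) p with hSdef
  haveI : Finite S := finite_kato_rat W p hodd T hpT hT 𝓤inf hUur
  -- the local groups are finite
  haveI hfinU : ∀ ℓ : ↥(T \ {primePlace p}),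
      Finite (galoisCohomology (GaloisRep.toLocal ℓ.1 (primaryGaloisModule W p)) 1) := fun ℓ => by
    haveI : CharZero (ℓ.1.adicCompletion ℚ) := charZero_adicCompletion _
    exact finite_galoisCohomology_one_primary_toLocal W p ℓ.1 (localEulerPoincareCharacteristic_holds _) (hpℓ ℓ)
  haveI hfinUr : ∀ ℓ : ↥(T \ {primePlace p}),
      Finite ↥(unramifiedSubgroup (GaloisRep.toLocal ℓ.1 (primaryGaloisModule W p)) 1) := fun ℓ => inferInstance
  haveI hfind : ∀ ℓ : ↥(T \ {primePlace p}),
      Finite (galoisCohomology ((W.torsionGaloisModule ((p ^ k : ℕ) : ℤ)).toLocal (Sum.inr ℓ.1)) 1) := fun ℓ =>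
    finite_galoisCohomology_one_toLocal _ _
  -- `G = ∏ ι_K⁻¹ H¹_ur ≤ ∏ H¹(ℚ_ℓ, E[p^K])`
  let C := fun ℓ : ↥(T \ {primePlace p}) =>
    (unramifiedSubgroup (GaloisRep.toLocal ℓ.1 (primaryGaloisModule W p)) 1).comap
      (galoisCohomology.map ((primaryInclusion W p k).restrictField (ℓ.1.adicCompletion ℚ)) 1)
  haveI hfinC : ∀ ℓ, Finite (C ℓ) := fun ℓ =>
    Finite.of_injective (fun z : C ℓ =>
      @id (galoisCohomology ((W.torsionGaloisModule ((p ^ k : ℕ) : ℤ)).toLocal (Sum.inr ℓ.1)) 1) z.1)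
      (fun a b h => Subtype.ext h)
  -- `G₀ = Sel^{(p^K)} ⊓ ker (E[p^K] ↪ E)_*`, finite, killed by `p^s p^K`; `H₀ = H` inside it
  have hn0 : ((p ^ k : ℕ) : ℤ) ≠ 0 := Int.natCast_ne_zero.mpr (pow_ne_zero _ hp.ne_zero)
  haveI : Finite (selmerGroup W ((p ^ k : ℕ) : ℤ)) := W.finite_selmerGroup_holds hn0
  haveI hfinG₀ : Finite ↥(selmerGroup W ((p ^ k : ℕ) : ℤ) ⊓ (torsionH1ToH1 W ((p ^ k : ℕ) : ℤ)).ker) :=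
    Finite.of_injective (AddSubgroup.inclusion inf_le_left) (AddSubgroup.inclusion_injective _)
  have hMd : ∀ m : geomTorsion W ((p ^ k : ℕ) : ℤ), (p ^ s * p ^ k) • m = 0 := fun m => by
    rw [mul_smul, pow_nsmul_geomTorsion_eq_zero, smul_zero]
  have hG₀' : ∀ c : galoisCohomology (W.torsionGaloisModule ((p ^ k : ℕ) : ℤ)) 1, (p ^ s * p ^ k) • c = 0 :=
    galoisCohomology.nsmul_eq_zero_of_forall _ hMd
  have hG₀ : ∀ x : ↥(selmerGroup W ((p ^ k : ℕ) : ℤ) ⊓ (torsionH1ToH1 W ((p ^ k : ℕ) : ℤ)).ker),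
      (p ^ s * p ^ k) • x = 0 := fun x => Subtype.ext (hG₀' x.1)
  set H₀ : AddSubgroup ↥(selmerGroup W ((p ^ k : ℕ) : ℤ) ⊓ (torsionH1ToH1 W ((p ^ k : ℕ) : ℤ)).ker) :=
    H.addSubgroupOf (selmerGroup W ((p ^ k : ℕ) : ℤ) ⊓ (torsionH1ToH1 W ((p ^ k : ℕ) : ℤ)).ker) with hH₀def
  have hH₀card : Nat.card H₀ = Nat.card H := Nat.card_congr (AddSubgroup.addSubgroupOfEquivOfLe hHle).toEquiv
  haveI : Finite (↥(selmerGroup W ((p ^ k : ℕ) : ℤ) ⊓ (torsionH1ToH1 W ((p ^ k : ℕ) : ℤ)).ker) ⧸ H₀) :=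
    Finite.of_surjective _ (QuotientAddGroup.mk'_surjective H₀)
  have hQ : ∀ q : ↥(selmerGroup W ((p ^ k : ℕ) : ℤ) ⊓ (torsionH1ToH1 W ((p ^ k : ℕ) : ℤ)).ker) ⧸ H₀, (p ^ s * p ^ k) • q = 0 := by
    intro q
    induction q using QuotientAddGroup.induction_on with
    | H x => rw [← QuotientAddGroup.mk_nsmul, hG₀ x, QuotientAddGroup.mk_zero]
  -- `Θ : G → ∏ H¹_ur`, surjective (part 43, `p^K` kills `H¹_ur`)
  let θ : ∀ ℓ : ↥(T \ {primePlace p}),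
      (∀ ℓ, C ℓ) →+ ↥(unramifiedSubgroup (GaloisRep.toLocal ℓ.1 (primaryGaloisModule W p)) 1) := fun ℓ =>
    { toFun := fun g =>
        ⟨galoisCohomology.map ((primaryInclusion W p k).restrictField (ℓ.1.adicCompletion ℚ)) 1 (g ℓ).1, (g ℓ).2⟩
      map_zero' := Subtype.ext (map_zero _)
      map_add' := fun a b => Subtype.ext (map_add _ _ _) }
  let Θ := AddMonoidHom.pi θ
  have hΘ : Function.Surjective Θ := fun u => by
    have hex : ∀ ℓ : ↥(T \ {primePlace p}), ∃ z ∈ C ℓ,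
        galoisCohomology.map ((primaryInclusion W p k).restrictField (ℓ.1.adicCompletion ℚ)) 1 z = (u ℓ).1 := fun ℓ =>
      exists_mem_comap_map_primaryInclusion_eq W p k ℓ.1 (u ℓ).2 (hK ℓ.1 ℓ.2 _ (u ℓ).2)
    choose z hz hzu using hex
    exact ⟨fun ℓ => ⟨z ℓ, hz ℓ⟩, funext fun ℓ => Subtype.ext (hzu ℓ)⟩
  -- `Λ : S → ∏ H¹_ur` (localisation), `Sel_{p^∞} ≤ ker Λ` (part 43)
  have hmemU : ∀ (c : S) (ℓ : ↥(T \ {primePlace p})),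
      galoisCohomology.localization (primaryGaloisModule W p) (Sum.inr ℓ.1) 1
          (c : galoisCohomology (primaryGaloisModule W p) 1) ∈
        unramifiedSubgroup (GaloisRep.toLocal ℓ.1 (primaryGaloisModule W p)) 1 := fun c ℓ => by
    have h := (SelmerStructure.mem_selmerGroup_iff _ _).1 c.2.1 (Sum.inr ℓ.1)
    rw [hUur ℓ.1 (hι ℓ).2] at h
    exact h
  let lam : ∀ ℓ : ↥(T \ {primePlace p}), S →+ ↥(unramifiedSubgroup (GaloisRep.toLocal ℓ.1 (primaryGaloisModule W p)) 1) :=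
    fun ℓ =>
    { toFun := fun c => ⟨galoisCohomology.localization (primaryGaloisModule W p) (Sum.inr ℓ.1) 1
          (c : galoisCohomology (primaryGaloisModule W p) 1), hmemU c ℓ⟩
      map_zero' := Subtype.ext (map_zero _)
      map_add' := fun a b => Subtype.ext (map_add _ _ _) }
  let Λ := AddMonoidHom.pi lam
  have hSel : Nat.card (W.selmerGroupPInfty p) ≤ Nat.card Λ.ker := by
    refine Nat.card_le_card_of_injective
      (fun c => (⟨⟨@id (galoisCohomology (primaryGaloisModule W p) 1) c.1,
          selmerGroupPInfty_le_kato W p 𝓤inf hUp hUur hUinl c.2⟩,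
        (AddMonoidHom.mem_ker).2 (funext fun ℓ => Subtype.ext
          (localization_eq_zero_of_mem_selmerGroupPInfty W p (hι ℓ).2 c.2))⟩ : Λ.ker)) ?_
    intro a b h
    have h' := congrArg (fun x : Λ.ker => @id (galoisCohomology (primaryGaloisModule W p) 1) x.1.1) h
    exact Subtype.ext h'
  -- the functionals `ev : G → Hom(G₀, ℤ/p^s p^K)`, `ev g x = Σ_ℓ ⟨g_ℓ, (desc^♭)_* loc_ℓ x⟩_ℓ`
  let δ : ∀ ℓ : ↥(T \ {primePlace p}),
      ↥(selmerGroup W ((p ^ k : ℕ) : ℤ) ⊓ (torsionH1ToH1 W ((p ^ k : ℕ) : ℤ)).ker) →+ _ := fun ℓ =>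
    ((galoisCohomology.map ((DiscreteGaloisModule.pairingDualIntertwining
        (ρ₁ := W.torsionGaloisModule ((p ^ k : ℕ) : ℤ)) (ρ₂ := W.torsionGaloisModule ((p ^ k : ℕ) : ℤ))
        (B := descendHom W (p ^ s) (p ^ k) e hμ hadd₁ hadd₂)
        (descendHom_smul W (p ^ s) (p ^ k) e hμ hadd₁ hadd₂ hgal)).restrictField (ℓ.1.adicCompletion ℚ)) 1).comp
      (galoisCohomology.localization (W.torsionGaloisModule ((p ^ k : ℕ) : ℤ)) (Sum.inr ℓ.1) 1)).comp
      (selmerGroup W ((p ^ k : ℕ) : ℤ) ⊓ (torsionH1ToH1 W ((p ^ k : ℕ) : ℤ)).ker).subtype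
  let π : ∀ ℓ : ↥(T \ {primePlace p}), (∀ ℓ, C ℓ) →+ _ := fun ℓ =>
    (C ℓ).subtype.comp (Pi.evalAddMonoidHom (fun ℓ => ↥(C ℓ)) ℓ)
  set ev : (∀ ℓ, C ℓ) →+ (↥(selmerGroup W ((p ^ k : ℕ) : ℤ) ⊓ (torsionH1ToH1 W ((p ^ k : ℕ) : ℤ)).ker) →+
      ZMod (p ^ s * p ^ k)) :=
    ∑ ℓ : ↥(T \ {primePlace p}),
      ((localTatePairingZMod (W.torsionGaloisModule ((p ^ k : ℕ) : ℤ)) (p ^ s * p ^ k) (Sum.inr ℓ.1)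
        (inv (Sum.inr ℓ.1))).compl₂ (δ ℓ)).comp (π ℓ) with hev_def
  have hev : ∀ g x, ev g x = ∑ ℓ : ↥(T \ {primePlace p}),
        localTatePairingZMod (W.torsionGaloisModule ((p ^ k : ℕ) : ℤ)) (p ^ s * p ^ k) (Sum.inr ℓ.1) (inv (Sum.inr ℓ.1))
          (g ℓ).1
          (galoisCohomology.map ((DiscreteGaloisModule.pairingDualIntertwining
              (ρ₁ := W.torsionGaloisModule ((p ^ k : ℕ) : ℤ)) (ρ₂ := W.torsionGaloisModule ((p ^ k : ℕ) : ℤ))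
              (B := descendHom W (p ^ s) (p ^ k) e hμ hadd₁ hadd₂)
              (descendHom_smul W (p ^ s) (p ^ k) e hμ hadd₁ hadd₂ hgal)).restrictField (ℓ.1.adicCompletion ℚ)) 1
            (galoisCohomology.localization (W.torsionGaloisModule ((p ^ k : ℕ) : ℤ)) (Sum.inr ℓ.1) 1 x.1)) := fun g x => by
    rw [hev_def, AddMonoidHom.finsetSum_apply, AddMonoidHom.finsetSum_apply]
    rfl
  -- every `ev g` kills `H₀`
  have hevH : ∀ g, ∀ x ∈ H₀, ev g x = 0 := fun g x hx => by
    rw [hev]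
    exact Finset.sum_eq_zero fun ℓ _ => hH ℓ (g ℓ).1 (g ℓ).2 x.1 (AddSubgroup.mem_addSubgroupOf.mp hx)
  -- (★): `Θ(ker ev) ≤ im Λ`
  have hker : ev.ker.map Θ ≤ Λ.range := by
    rintro _ ⟨g, hg, rfl⟩
    have hg' : ∀ x ∈ selmerGroup W ((p ^ k : ℕ) : ℤ) ⊓ (torsionH1ToH1 W ((p ^ k : ℕ) : ℤ)).ker,
        ∑ ℓ : ↥(T \ {primePlace p}),
          localTatePairingZMod (W.torsionGaloisModule ((p ^ k : ℕ) : ℤ)) (p ^ s * p ^ k) (Sum.inr ℓ.1) (inv (Sum.inr ℓ.1))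
            (g ℓ).1
            (galoisCohomology.map ((DiscreteGaloisModule.pairingDualIntertwining
                (ρ₁ := W.torsionGaloisModule ((p ^ k : ℕ) : ℤ)) (ρ₂ := W.torsionGaloisModule ((p ^ k : ℕ) : ℤ))
                (B := descendHom W (p ^ s) (p ^ k) e hμ hadd₁ hadd₂)
                (descendHom_smul W (p ^ s) (p ^ k) e hμ hadd₁ hadd₂ hgal)).restrictField (ℓ.1.adicCompletion ℚ)) 1
              (galoisCohomology.localization (W.torsionGaloisModule ((p ^ k : ℕ) : ℤ)) (Sum.inr ℓ.1) 1 x)) = 0 :=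
      fun x hx => by
        rw [← hev g ⟨x, hx⟩, (AddMonoidHom.mem_ker).1 hg, AddMonoidHom.zero_apply]
    obtain ⟨c, hcS, hcloc⟩ := exists_mem_kato_of_sum_eq_zero W p s k T e hμ hadd₁ hadd₂ hgal inv hodd hk1 halt hnondeg
      hperf hcompl hpT hT 𝓤inf hUp hUur hUinl 𝓖' hle h𝓖good h𝓖T h𝓖p hs g hg'
    exact AddMonoidHom.mem_range.2 ⟨⟨c, hcS⟩, funext fun ℓ => Subtype.ext (hcloc ℓ)⟩
  -- the count
  have h1 : Nat.card (∀ ℓ : ↥(T \ {primePlace p}), ↥(unramifiedSubgroup (GaloisRep.toLocal ℓ.1 (primaryGaloisModule W p)) 1)) ≤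
      Nat.card (ev.ker.map Θ) * ev.ker.index := natCard_le_natCard_map_mul_index Θ hΘ ev.ker
  have h2 : Nat.card (ev.ker.map Θ) ≤ Nat.card Λ.range := AddSubgroup.card_le_of_le hker
  have h3 : ev.ker.index ≤ Nat.card (↥(selmerGroup W ((p ^ k : ℕ) : ℤ) ⊓ (torsionH1ToH1 W ((p ^ k : ℕ) : ℤ)).ker) ⧸ H₀) :=
    index_ker_le_natCard_quotient H₀ hQ ev hevH
  have h4 : Nat.card (↥(selmerGroup W ((p ^ k : ℕ) : ℤ) ⊓ (torsionH1ToH1 W ((p ^ k : ℕ) : ℤ)).ker) ⧸ H₀) * Nat.card H =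
      Nat.card ↥(selmerGroup W ((p ^ k : ℕ) : ℤ) ⊓ (torsionH1ToH1 W ((p ^ k : ℕ) : ℤ)).ker) := by
    rw [← hH₀card, ← AddSubgroup.card_eq_card_quotient_mul_card_addSubgroup H₀]
  have h5 : Nat.card S = Nat.card Λ.ker * Nat.card Λ.range := by
    rw [AddSubgroup.card_eq_card_quotient_mul_card_addSubgroup Λ.ker, mul_comm,
      Nat.card_congr (QuotientAddGroup.quotientKerEquivRange Λ).toEquiv]
  calc Nat.card (W.selmerGroupPInfty p) *
        (∏ v ∈ T \ {primePlace p}, Nat.card (unramifiedSubgroup (GaloisRep.toLocal v (primaryGaloisModule W p)) 1)) * Nat.card H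
      = Nat.card (W.selmerGroupPInfty p) *
          (Nat.card (∀ ℓ : ↥(T \ {primePlace p}), ↥(unramifiedSubgroup (GaloisRep.toLocal ℓ.1 (primaryGaloisModule W p)) 1)) *
            Nat.card H) := by
        rw [← Finset.prod_coe_sort, ← Nat.card_pi, mul_assoc]
    _ ≤ Nat.card Λ.ker * (Nat.card Λ.range *
          Nat.card (↥(selmerGroup W ((p ^ k : ℕ) : ℤ) ⊓ (torsionH1ToH1 W ((p ^ k : ℕ) : ℤ)).ker) ⧸ H₀) * Nat.card H) :=
        Nat.mul_le_mul hSel (Nat.mul_le_mul_right _ (h1.trans (Nat.mul_le_mul h2 h3)))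
    _ = Nat.card S * Nat.card ↥(selmerGroup W ((p ^ k : ℕ) : ℤ) ⊓ (torsionH1ToH1 W ((p ^ k : ℕ) : ℤ)).ker) := by
        rw [mul_assoc (Nat.card Λ.range), h4, ← mul_assoc, ← h5]

include hμ hadd₁ hadd₂ hgal in
/-- **The sharp bound with the Mordell–Weil index: `#Sel_{p^∞}(E/ℚ) · ∏_{ℓ ∈ T∖{p}} #H¹_ur(ℚ_ℓ, E[p^∞]) · #H ≤ #S · [E(ℚ) : p^K E(ℚ)]`**
(`#G₀ = [E(ℚ) : p^K E(ℚ)]`, part 41 `natCard_selmerGroup_inf_ker_torsionH1ToH1`; `= #E(ℚ)[p^∞]` in rank `0` for `K ≫ 0`).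
[cite: Kato2004Asterisque, §14.8 (p. 238) and proof of Prop. 14.16 (pp. 244–245)] [cite: SilvermanAEC2009, VIII §2 and Thm. X.4.2 (a)] -/
theorem natCard_selmerGroupPInfty_mul_prod_unramified_mul_le_index
    (hodd : p ≠ 2) (hk1 : 1 ≤ k)
    (halt : ∀ P, e P P = 1) (hnondeg : ∀ P, (∀ Q, e Q P = 1) → P = 0) (hperf : inv.IsPerfect)
    (hcompl : inv.SelmerComplement)
    (hpT : primePlace p ∈ T) (hT : ∀ v : HeightOneSpectrum (𝓞 ℚ), v ∉ T → W.HasGoodReductionAt v)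
    [Finite (W.selmerGroupPInfty p)]
    (𝓤inf : SelmerStructure (primaryGaloisModule W p))
    (hUp : 𝓤inf (Sum.inr (primePlace p)) = ⊤)
    (hUur : ∀ v : HeightOneSpectrum (𝓞 ℚ), v ≠ primePlace p →
      𝓤inf (Sum.inr v) = unramifiedSubgroup (GaloisRep.toLocal v (primaryGaloisModule W p)) 1)
    (hUinl : ∀ w : InfinitePlace ℚ, 𝓤inf (Sum.inl w) = ⊤)
    (𝓖' : SelmerStructure (W.torsionGaloisModule ((p ^ s * p ^ k : ℕ) : ℤ)))
    (hle : W.kummerSelmerStructure ((p ^ s * p ^ k : ℕ) : ℤ) ≤ 𝓖')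
    (h𝓖good : ∀ v : HeightOneSpectrum (𝓞 ℚ), v ∉ T →
      𝓖' (Sum.inr v) = unramifiedSubgroup (GaloisRep.toLocal v (W.torsionGaloisModule ((p ^ s * p ^ k : ℕ) : ℤ))) 1)
    (h𝓖T : ∀ v ∈ T, v ≠ primePlace p →
      𝓖' (Sum.inr v) = (unramifiedSubgroup (GaloisRep.toLocal v (primaryGaloisModule W p)) 1).comap
        (galoisCohomology.map (((primaryInclusion W p (s + k)).comp
          (W.torsionInclusion (natCast_pow_mul_pow_dvd_natCast_pow_add p s k))).restrictField (v.adicCompletion ℚ)) 1))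
    (h𝓖p : 𝓖' (Sum.inr (primePlace p)) = W.kummerSelmerStructure ((p ^ s * p ^ k : ℕ) : ℤ) (Sum.inr (primePlace p)))
    (hs : ∀ a ∈ W.sha, ((p ^ s * p ^ k : ℕ) : ℤ) • a = 0 → p ^ s • a = 0)
    (hK : ∀ v ∈ T \ {primePlace p},
      ∀ u ∈ unramifiedSubgroup (GaloisRep.toLocal v (primaryGaloisModule W p)) 1, p ^ k • u = 0)
    (H : AddSubgroup (galH1Torsion W ((p ^ k : ℕ) : ℤ)))
    (hHle : H ≤ selmerGroup W ((p ^ k : ℕ) : ℤ) ⊓ (torsionH1ToH1 W ((p ^ k : ℕ) : ℤ)).ker)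
    (hH : ∀ ℓ : ↥(T \ {primePlace p}),
      ∀ gℓ ∈ (unramifiedSubgroup (GaloisRep.toLocal ℓ.1 (primaryGaloisModule W p)) 1).comap
        (galoisCohomology.map ((primaryInclusion W p k).restrictField (ℓ.1.adicCompletion ℚ)) 1),
      ∀ x ∈ H,
        localTatePairingZMod (W.torsionGaloisModule ((p ^ k : ℕ) : ℤ)) (p ^ s * p ^ k) (Sum.inr ℓ.1) (inv (Sum.inr ℓ.1)) gℓ
          (galoisCohomology.map ((DiscreteGaloisModule.pairingDualIntertwining
              (ρ₁ := W.torsionGaloisModule ((p ^ k : ℕ) : ℤ)) (ρ₂ := W.torsionGaloisModule ((p ^ k : ℕ) : ℤ))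
              (B := descendHom W (p ^ s) (p ^ k) e hμ hadd₁ hadd₂)
              (descendHom_smul W (p ^ s) (p ^ k) e hμ hadd₁ hadd₂ hgal)).restrictField (ℓ.1.adicCompletion ℚ)) 1
            (galoisCohomology.localization (W.torsionGaloisModule ((p ^ k : ℕ) : ℤ)) (Sum.inr ℓ.1) 1 x)) = 0) :
    Nat.card (W.selmerGroupPInfty p) *
        (∏ v ∈ T \ {primePlace p}, Nat.card (unramifiedSubgroup (GaloisRep.toLocal v (primaryGaloisModule W p)) 1)) *
        Nat.card H ≤
      Nat.card ↥(𝓤inf.selmerGroup ⊓ selmerLocalKerPrimary W ((primePlace p).adicCompletion ℚ) p) *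
        (zsmulAddGroupHom ((p ^ k : ℕ) : ℤ) : W.toAffine.Point →+ W.toAffine.Point).range.index := by
  have hn0 : ((p ^ k : ℕ) : ℤ) ≠ 0 := Int.natCast_ne_zero.mpr (pow_ne_zero _ (Fact.out : p.Prime).ne_zero)
  have h := natCard_selmerGroupPInfty_mul_prod_unramified_mul_le W p s k T e hμ hadd₁ hadd₂ hgal inv hodd hk1 halt hnondeg
    hperf hcompl hpT hT 𝓤inf hUp hUur hUinl 𝓖' hle h𝓖good h𝓖T h𝓖p hs hK H hHle hH
  rw [natCard_selmerGroup_inf_ker_torsionH1ToH1 W hn0] at h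
  convert h

end PT

end Summit.BirchSwinnertonDyer.BirchSwinnertonDyer.Theorems.KatoFiniteLevelCount

end
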